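import Summits.QuantumFields.QCD.Theses.NestedDissectionSea
import Summits.QuantumFields.QCD.Theorems.NestedDissectionSeaCoerciveOfDiluteLineDefs
import Summits.QuantumFields.QCD.Theorems.CoerciveSea.Negative.PinSelfSufficiency
import Summits.QuantumFields.QCD.Theorems.EarlyCrosserLaw.Negative.OnBranchWithoutLowerPin

/-!
# Crux `FrameAndSeparatorLaw` (route `NestedDissectionSea`, item stmt-QuantumFields-17012), negative side —
# the crux splits as `Frame ∧ SeparatorLawLarge`; in the frame (α) the LOWER pin is load-bearing

Refuter crux-attack record (refuter-rattack-stmt-QuantumFields-17012-0, 2026-08-17).  No refutation: the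
crux survives the cheap attacks.  Sorry-free, standard axioms; written over the standing disprovers'
vocabulary (`CoerciveSeaNegative.PinClause`, `EarlyCrosserLawNegative.UpperPin`, `heavyJunkReg`) so that
nothing is duplicated.

* `frameAndSeparatorLaw_iff` (`Iff.rfl`): the crux is LITERALLY `Frame ∧ SeparatorLawLarge`, where
  `SeparatorLawLarge` is the landed definition (`NestedDissectionSeaCoerciveOfDiluteLineDefs`) of the
  registered stub `stub_separatorLawLarge` of crux 13901's built line — so conjunct (β) closes by `exact`
  from a proof of that stub, and composes with `coerciveSea_of_pinnedDilutionOnBranch_of_separatorLawLarge`.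
* `twoSidedPin_iff`: the hypothesis of (α) at `(m, R)` is exactly `PinClause ∧ UpperPin` (clauses (b),(b″)
  of `EarlyCrosserLaw` under one eventuality).
* `frame_hypothesis_asymptotics`: what the (α) hypothesis gives DETERMINISTICALLY (via the tree's
  `PinSelfSufficiency`): `a_k/Z_m k → 0`, `limsup mcrit ≤ 0`, `liminf mcrit ≥ −8`.  The content of (α) is
  therefore exactly `liminf mcrit ≥ 0`: excluding a two-sided parity jump inside `(−8, 0)` at lattice
  distance `≳ 1` below `0`.
* `frameWithoutLowerPin_false`: (α) with the lower pin deleted from its hypothesis is FALSE — along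
  `heavyJunkReg 2` (`mcrit ≡ 1`) the upper pin holds outright (Seiler positivity empties its indicator,
  `withoutLowerPinAt_heavyJunkReg`) while `mcrit ↛ 0`.  Any proof of (α) must use the lower pin.

No Theses statement is asserted positively; the three `def`s are statement abbreviations, not facts.
-/

noncomputable section

open scoped BigOperators Classical
open MeasureTheory Filter Matrix
open Literature.MathematicalPhysics.QuantumLattice Literature.MathematicalPhysics.QuantumFieldTheory
  Literature.Probability.LatticeModels
open Summit.QuantumFields.QCD.Theses.NestedDissectionSea
open Summit.QuantumFields.QCD.Theorems.CoerciveSeaNegative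
open Summit.QuantumFields.QCD.Theorems.EarlyCrosserLawNegative

namespace Summit.QuantumFields.QCD.Theorems.FrameAndSeparatorLawNegative

/-- **The two-sided parity pin** — the hypothesis body of conjunct (α) of the crux for given
`(Nf, reg, M₀, m, R)`, VERBATIM: for every `M > M₀`, eventually in `k`, on every odd torus of physical
side `≥ R` the phase-quenched probability of `Re det D_W(mcrit k − a_k M/Z_m k) < 0` is `≥ 1/4`, and on
those of side `≤ 2R` the probability of `Re det D_W(mcrit k + a_k M/Z_m k) < 0` is `≤ 1/8` (a statement
abbreviation for the analysis, not a fact). -/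
def TwoSidedPin (Nf : ℕ) (reg : QCDRegularisation Nf) (M₀ : ℝ) (m : Fin Nf → ℝ) (R : ℝ) : Prop :=
  ∀ M : ℝ, M₀ < M → ∀ᶠ k : ℕ in Filter.atTop, ∀ S : ℕ, R ≤ reg.a k * (2 * S + 1) → let N : ℕ := 2 * S + 1; let mq : Fin Nf → ℝ := fun f => reg.mcrit k + reg.a k * m f / reg.Zm k; let wt : GaugeConfig 4 N (Matrix.specialUnitaryGroup (Fin 3) ℂ) → ℝ := fun U => ∏ f, ‖fermionDet (wilsonDirac (fundamentalRep (Fin 3)) U (mq f) 1)‖; let Pneg : ℝ → ℝ := fun μ => (∫ U, (if (fermionDet (wilsonDirac (fundamentalRep (Fin 3)) U μ 1)).re < 0 then (1 : ℝ) else 0) * wt U ∂(wilsonMeasure (d := 4) (L := N) (fundamentalRep (Fin 3)) (reg.β k))) / (∫ U, wt U ∂(wilsonMeasure (d := 4) (L := N) (fundamentalRep (Fin 3)) (reg.β k))); (1 / 4 : ℝ) ≤ Pneg (reg.mcrit k - reg.a k * M / reg.Zm k) ∧ (reg.a k * (2 * S + 1) ≤ 2 * R → Pneg (reg.mcrit k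 + reg.a k * M / reg.Zm k) ≤ (1 / 8 : ℝ))

/-- **Conjunct (α) of the crux (the FRAME)**, VERBATIM modulo the abbreviation `TwoSidedPin`: along every
admissible regularisation of `N_f ∈ {2,3}`, a two-sided pin above some threshold `M₀ ≥ 0` forces
`mcrit k → 0` (a statement abbreviation for the analysis, not a fact; OPEN). -/
def Frame : Prop :=
  ∀ (Nf : ℕ) (reg : QCDRegularisation Nf), (Nf = 2 ∨ Nf = 3) → reg.HasMassScaling → (reg.scheme 0 0 0).HasAsymptoticScaling → ∀ M₀ : ℝ, 0 ≤ M₀ → (∀ m : Fin Nf → ℝ, (∀ f, M₀ < m f) → ∃ R : ℝ, 0 < R ∧ TwoSidedPin Nf reg M₀ m R) → Filter.Tendsto reg.mcrit Filter.atTop (nhds 0)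

/-- **The crux is literally `Frame ∧ SeparatorLawLarge`** (definitional unfolding), `SeparatorLawLarge`
being the landed definition of the registered stub `stub_separatorLawLarge` of crux 13901's built line.
[folklore] -/
theorem frameAndSeparatorLaw_iff :
    FrameAndSeparatorLaw ↔
      (Frame ∧ Summit.QuantumFields.QCD.Cruxes.CoerciveOfDilute.SeaPaysPoles.SeparatorLawLarge) :=
  Iff.rfl

/-- **The two-sided pin splits** into the lower pin `PinClause` (VERBATIM clause (iii) of `CoerciveSea` =
(b) of `EarlyCrosserLaw`) and the upper pin `UpperPin` (VERBATIM (b″) of `EarlyCrosserLaw`). [folklore] -/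
theorem twoSidedPin_iff (Nf : ℕ) (reg : QCDRegularisation Nf) (M₀ : ℝ) (m : Fin Nf → ℝ) (R : ℝ) :
    TwoSidedPin Nf reg M₀ m R ↔ PinClause Nf reg M₀ m R ∧ UpperPin Nf reg M₀ m R := by
  constructor
  · intro h
    refine ⟨fun M hM => ?_, fun M hM => ?_⟩
    · filter_upwards [h M hM] with k hk S hS
      exact (hk S hS).1
    · filter_upwards [h M hM] with k hk S hS hS2
      exact (hk S hS).2 hS2
  · rintro ⟨hlo, hup⟩ M hM
    filter_upwards [hlo M hM, hup M hM] with k hk1 hk2 S hS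
    exact ⟨hk1 S hS, fun hS2 => hk2 S hS hS2⟩

/-- **What the hypothesis of (α) gives deterministically** (any `N_f`, any `M₀ ≥ 0`, no scaling
hypothesis; via the tree's `PinSelfSufficiency`): `a_k/Z_m k → 0`, `limsup mcrit ≤ 0` and
`liminf mcrit ≥ −8`.  The open content of (α) is `liminf mcrit ≥ 0`. [folklore] -/
theorem frame_hypothesis_asymptotics {Nf : ℕ} (reg : QCDRegularisation Nf) {M₀ : ℝ} (hM₀ : 0 ≤ M₀)
    (h : ∀ m : Fin Nf → ℝ, (∀ f, M₀ < m f) → ∃ R : ℝ, 0 < R ∧ TwoSidedPin Nf reg M₀ m R) :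
    Tendsto (fun k => reg.a k / reg.Zm k) atTop (nhds 0) ∧
      (∀ η : ℝ, 0 < η → ∀ᶠ k in atTop, reg.mcrit k < η) ∧ (∀ᶠ k in atTop, -8 < reg.mcrit k) := by
  obtain ⟨R, -, hpin2⟩ := h (fun _ => M₀ + 1) (fun _ => by linarith)
  have hpin : PinClause Nf reg M₀ (fun _ => M₀ + 1) R := ((twoSidedPin_iff _ _ _ _ _).1 hpin2).1
  exact ⟨hpin.tendsto_a_div_Zm, fun η hη => hpin.mcrit_lt_eventually hη,
    hpin.neg_eight_lt_mcrit_eventually (by linarith)⟩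

/-- **`Frame` with the LOWER pin deleted** from its hypothesis (only the upper pin (b″) kept) — a
statement abbreviation; FALSE, see `frameWithoutLowerPin_false`. -/
def FrameWithoutLowerPin : Prop :=
  ∀ (Nf : ℕ) (reg : QCDRegularisation Nf), (Nf = 2 ∨ Nf = 3) → reg.HasMassScaling → (reg.scheme 0 0 0).HasAsymptoticScaling → ∀ M₀ : ℝ, 0 ≤ M₀ → (∀ m : Fin Nf → ℝ, (∀ f, M₀ < m f) → ∃ R : ℝ, 0 < R ∧ UpperPin Nf reg M₀ m R) → Filter.Tendsto reg.mcrit Filter.atTop (nhds 0)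

/-- **The lower pin is load-bearing in (α).** With only the upper pin the frame FAILS: along the heavy
junk regularisation `heavyJunkReg 2` (`canonicalAF` with `mcrit ≡ 1`; both scalings) the upper pin holds
outright — its indicator vanishes by Seiler positivity (`withoutLowerPinAt_heavyJunkReg`) — while
`mcrit ≡ 1 ↛ 0`. [folklore] -/
theorem frameWithoutLowerPin_false : ¬ FrameWithoutLowerPin := by
  intro hF
  obtain ⟨hms, has, M₀, hM₀, b₀, hb₀, ℓ, hℓ, hm⟩ := withoutLowerPinAt_heavyJunkReg 2
  have hT : Tendsto (heavyJunkReg 2).mcrit atTop (nhds 0) :=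
    hF 2 (heavyJunkReg 2) (Or.inl rfl) hms has M₀ hM₀ fun m hmm => by
      obtain ⟨R, hR, -, hup⟩ := hm m hmm
      exact ⟨R, hR, hup⟩
  have h1 : Tendsto (heavyJunkReg 2).mcrit atTop (nhds 1) := tendsto_const_nhds
  have h01 := tendsto_nhds_unique hT h1
  norm_num at h01

end Summit.QuantumFields.QCD.Theorems.FrameAndSeparatorLawNegative

end
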